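import Summits.PneNP.PneNP.Theorems.ChebyshevTracialDesignVirtualBimodePsd
import Summits.PneNP.PneNP.Theorems.ChebyshevTracialDesignNonCrossingCellDesign
import HarnessLib

/-!
# Cell pnp-psdrank, route `ChebyshevTracialDesign`: the EXACT MODE BUDGET of a tight strategy — its virtual value is
# `Σ_{κ ≤ D/2} (R_κ − 1)·C_κ − Σ_{κ > D/2} C_κ` in the Hilbert–Schmidt tight modes `C_κ`, with `R_κ − 1 = ρ_{2κ} = O(κ/n)`

Harmonic backbone of the crux `TracialDecayExp20` (stmt-PneNP-19878), brick 45c (prover g10; MEMO-12 §2(d) made exact). For `n` even,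
`t = 2c'+1`, `2t ≤ n`, `D ≤ 2c'`, matrix-valued `X` on the odd cuts and `Y` on the perfect matchings (any dimension `r`, NO positivity needed)
with entrywise harmonic layers `p^{ab}` of `U ↦ X_U[a,b]` on the `t`-cuts, and the Hilbert–Schmidt tight modes
`C_κ = Σ_{(a,b)} Σ_M Y_M[b,a] Σ_{|U|=t} ((Wᵀ)^{t−2κ}p^{ab}_{2κ})(U)·1[cc(U,M) = 1]`:
* §1 `layerRatio_le_one_add` — the quantitative form of brick 44b's `layerRatio_le_two_pow`:
  `R_κ ≤ 1 + 2κ·y`, `y = 1/(2a+2−2κ) + 1/(n−2a−2κ) + 1/((2a+2−2κ)(n−2a−2κ))`, whenever `2κy ≤ 1` (so `ρ_{2κ} = R_κ − 1 ≤ 2κy ≈ 8κ/n`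
  on balanced cuts);
* §2 `tight_modes_sum_eq_zero` — if `tr(X_U Y_M) = 0` on the tight pairs with `|U| = t` (e.g. `IsPsdRect X Y`), then `Σ_{κ=0}^{c'} C_κ = 0`
  (the HS form of brick 25's tightness identity: expand `tr(X_U Y_M)` entrywise, each entry in layers, odd layers invisible);
* §3 **`tight_virtual_modeBudget`** — hence, by brick 45b (`virtual_psd_mul_eq`), the virtual value satisfies
  `(Σ_M Σ_{|A|≤D} tr(Q_A Y_M)·K_M(A))·N₁ = Σ_{κ=1}^{D/2} (R_κ − 1)·C_κ − Σ_{κ=D/2+1}^{c'} C_κ`: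
  for a TIGHT strategy the overlap `C_0 = N₁·|PM|·tr(X̄Ȳ)` cancels against the tight modes and only the SMALL re-weightings `ρ_{2κ} C_κ` of the
  low modes and the deep modes remain — the crux asks that this be `≥ −e^{−a dq n}·r·N₁|PM|` for psd contractions in the dimension budget.
[cite: Grigoriev2001, Lemma 1.4 (PDF p. 8)] [cite: Rothvoss2017, §2 (PDF p. 6)] [cite: GriblingDelaatLaurent2019, §5] [cite: BrouwerHaemers2012, Prop. 4.3.2 (PDF p. 83)]
Stature: support/instrument (no defs). WHAT THIS IS NOT: not virtual nonnegativity, nothing on psd rank, no P-vs-NP content. Supports stmt-PneNP-19878.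
-/

set_option linter.dupNamespace false -- `Summit.PneNP.PneNP.…`: summit = sub-problem (D-0017)

noncomputable section

namespace Summit.PneNP.PneNP.Theorems.ChebyshevTracialDesignTightModeBudget

open Finset Matrix Literature.Barriers.PneNP Literature.Computability.Complexity Literature.Combinatorics.Optimization
open Literature.Combinatorics.AssociationSchemes Literature.Combinatorics.AssociationSchemes.JohnsonHarmonics
open Literature.Combinatorics.AssociationSchemes.JohnsonSpectrum
open Summit.PneNP.PneNP.Theorems.ChebyshevTracialDesignTightColumnSums
open Summit.PneNP.PneNP.Theorems.ChebyshevTracialDesignTightLayerBimode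
open Summit.PneNP.PneNP.Theorems.ChebyshevTracialDesignTracialProfilePolynomial (trace_mul_eq_sum_pairs)
open Summit.PneNP.PneNP.Theorems.ChebyshevTracialDesignVirtualBimodePsd
open Summit.PneNP.PneNP.Theorems.ChebyshevTracialDesignNonCrossingCellDesign (one_add_pow_le_of_small)

variable {n : ℕ}

/-! ### §1 The layer ratio quantitatively: `R_κ ≤ 1 + 2κy` -/

/-- **`R_κ ≤ 1 + 2κ·y`** with `y = 1/(2a+2−2κ) + 1/(n−2a−2κ) + 1/((2a+2−2κ)(n−2a−2κ))`, for `κ ≤ a`, `2(2a+1) ≤ n` and `2κy ≤ 1`: every factor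
of the layer ratio is `(1 + 1/x)(1 + 1/z) ≤ 1 + y` (`x ≥ 2a+2−2κ`, `z ≥ n−2a−2κ`). [cite: Grigoriev2001, Lemma 1.4 (PDF p. 8)] -/
theorem layerRatio_le_one_add {a κ : ℕ} (ht : 2 * (2 * a + 1) ≤ n) (hκa : κ ≤ a)
    (hy : 2 * κ * (1 / ((2 * a + 2 : ℝ) - 2 * κ) + 1 / ((n : ℝ) - 2 * a - 2 * κ) +
      1 / (((2 * a + 2 : ℝ) - 2 * κ) * ((n : ℝ) - 2 * a - 2 * κ))) ≤ 1) :
    ∏ i ∈ range κ, (((2 * a + 1 : ℝ) - 2 * i) * ((n : ℝ) - 2 * a - 1 - 2 * i) /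
        (((2 * a : ℝ) - 2 * i) * ((n : ℝ) - 2 * a - 2 - 2 * i))) ≤
      1 + 2 * κ * (1 / ((2 * a + 2 : ℝ) - 2 * κ) + 1 / ((n : ℝ) - 2 * a - 2 * κ) +
        1 / (((2 * a + 2 : ℝ) - 2 * κ) * ((n : ℝ) - 2 * a - 2 * κ))) := by
  set x₀ : ℝ := (2 * a + 2 : ℝ) - 2 * κ with hx₀
  set z₀ : ℝ := (n : ℝ) - 2 * a - 2 * κ with hz₀
  set y : ℝ := 1 / x₀ + 1 / z₀ + 1 / (x₀ * z₀) with hydef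
  have hx₀pos : 0 < x₀ := by
    rw [hx₀]; have : (2 * κ : ℝ) ≤ 2 * a := by exact_mod_cast (show 2 * κ ≤ 2 * a by omega)
    linarith
  have hz₀pos : 0 < z₀ := by
    rw [hz₀]; have : (2 * a + 2 * κ + 2 : ℝ) ≤ n := by exact_mod_cast (show 2 * a + 2 * κ + 2 ≤ n by omega)
    linarith
  have hy0 : 0 ≤ y := by rw [hydef]; positivity
  -- each factor is at most `1 + y`
  have hfac : ∀ i ∈ range κ, (((2 * a + 1 : ℝ) - 2 * i) * ((n : ℝ) - 2 * a - 1 - 2 * i) /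
      (((2 * a : ℝ) - 2 * i) * ((n : ℝ) - 2 * a - 2 - 2 * i))) ≤ 1 + y := by
    intro i hi
    have hi' := mem_range.1 hi
    have hx : x₀ ≤ (2 * a : ℝ) - 2 * i := by
      rw [hx₀]; have : (2 * i + 2 : ℝ) ≤ 2 * κ := by exact_mod_cast (show 2 * i + 2 ≤ 2 * κ by omega)
      linarith
    have hz : z₀ ≤ (n : ℝ) - 2 * a - 2 - 2 * i := by
      rw [hz₀]; have : (2 * i + 2 : ℝ) ≤ 2 * κ := by exact_mod_cast (show 2 * i + 2 ≤ 2 * κ by omega)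
      linarith
    have hxp : 0 < (2 * a : ℝ) - 2 * i := hx₀pos.trans_le hx
    have hzp : 0 < (n : ℝ) - 2 * a - 2 - 2 * i := hz₀pos.trans_le hz
    rw [div_le_iff₀ (mul_pos hxp hzp)]
    -- `(x+1)(z+1) ≤ (1+y) x z` with `y ≥ 1/x + 1/z + 1/(xz)` at the actual `x, z`
    have h1 : 1 / ((2 * a : ℝ) - 2 * i) ≤ 1 / x₀ := one_div_le_one_div_of_le hx₀pos hx
    have h2 : 1 / ((n : ℝ) - 2 * a - 2 - 2 * i) ≤ 1 / z₀ := one_div_le_one_div_of_le hz₀pos hz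
    have h3 : 1 / (((2 * a : ℝ) - 2 * i) * ((n : ℝ) - 2 * a - 2 - 2 * i)) ≤ 1 / (x₀ * z₀) :=
      one_div_le_one_div_of_le (mul_pos hx₀pos hz₀pos) (mul_le_mul hx hz hz₀pos.le hxp.le)
    have hyi : 1 / ((2 * a : ℝ) - 2 * i) + 1 / ((n : ℝ) - 2 * a - 2 - 2 * i) +
        1 / (((2 * a : ℝ) - 2 * i) * ((n : ℝ) - 2 * a - 2 - 2 * i)) ≤ y := by rw [hydef]; linarith
    -- `(x+1)(z+1) = xz + (x + z + 1)` and `x + z + 1 = (1/x + 1/z + 1/(xz))·xz ≤ y·xz`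
    have hxne : (2 * a : ℝ) - 2 * i ≠ 0 := hxp.ne'
    have hzne : (n : ℝ) - 2 * a - 2 - 2 * i ≠ 0 := hzp.ne'
    have hkey : (1 / ((2 * a : ℝ) - 2 * i) + 1 / ((n : ℝ) - 2 * a - 2 - 2 * i) +
        1 / (((2 * a : ℝ) - 2 * i) * ((n : ℝ) - 2 * a - 2 - 2 * i))) *
          (((2 * a : ℝ) - 2 * i) * ((n : ℝ) - 2 * a - 2 - 2 * i)) =
        ((n : ℝ) - 2 * a - 2 - 2 * i) + ((2 * a : ℝ) - 2 * i) + 1 := by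
      rw [add_mul, add_mul, one_div_mul_cancel (mul_ne_zero hxne hzne), one_div, one_div, inv_mul_cancel_left₀ hxne,
        mul_comm ((2 * a : ℝ) - 2 * i), inv_mul_cancel_left₀ hzne]
    have hyxz := mul_le_mul_of_nonneg_right hyi (mul_pos hxp hzp).le
    rw [hkey] at hyxz
    nlinarith [hyxz]
  have hnonneg : ∀ i ∈ range κ, 0 ≤ (((2 * a + 1 : ℝ) - 2 * i) * ((n : ℝ) - 2 * a - 1 - 2 * i) /
      (((2 * a : ℝ) - 2 * i) * ((n : ℝ) - 2 * a - 2 - 2 * i))) := by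
    intro i hi
    have hi' := mem_range.1 hi
    have hxp : 0 < (2 * a : ℝ) - 2 * i := by
      have : (2 * i + 2 : ℝ) ≤ 2 * a := by exact_mod_cast (show 2 * i + 2 ≤ 2 * a by omega)
      linarith
    have hzp : 0 < (n : ℝ) - 2 * a - 2 - 2 * i := by
      have : (2 * a + 2 * i + 4 : ℝ) ≤ n := by exact_mod_cast (show 2 * a + 2 * i + 4 ≤ n by omega)
      linarith
    exact div_nonneg (mul_nonneg (by linarith) (by linarith)) (mul_pos hxp hzp).le
  calc _ ≤ ∏ _i ∈ range κ, (1 + y) := prod_le_prod hnonneg hfac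
    _ = (1 + y) ^ κ := by rw [prod_const, card_range]
    _ ≤ 1 + 2 * κ * y := one_add_pow_le_of_small hy0 κ (by rw [hydef]; exact hy)

/-! ### §2 The Hilbert–Schmidt tightness identity -/

/-- **The tight modes of a tight strategy sum to zero.** For `t = 2c'+1`, matrix-valued `X`, `Y` with `tr(X_U Y_M) = 0` whenever `|U| = t`
and `cc(U,M) = 1`, and entrywise harmonic layers `p^{ab}` of `X` on the `t`-cuts: `Σ_{κ=0}^{c'} C_κ = 0`.
[cite: Rothvoss2017, §2 (PDF p. 6)] [cite: BrouwerHaemers2012, Prop. 4.3.2 (PDF p. 83)] -/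
theorem tight_modes_sum_eq_zero {c' r : ℕ}
    (X : OddSet n → Matrix (Fin r) (Fin r) ℝ) (Y : PMatch n → Matrix (Fin r) (Fin r) ℝ)
    (htight : ∀ (U : OddSet n) (M : PMatch n), U.1.card = 2 * c' + 1 → cc U M = 1 → (X U * Y M).trace = 0)
    (p : Fin r × Fin r → ℕ → Finset (Fin n) → ℝ) (hp : ∀ ab j, IsHarmonic j (p ab j))
    (hpdec : ∀ ab (U : OddSet n), U.1.card = 2 * c' + 1 →
      X U ab.1 ab.2 = (∑ j ∈ range (2 * c' + 1 + 1), up^[2 * c' + 1 - j] (p ab j)) U.1) :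
    ∑ κ ∈ range (c' + 1), ∑ ab : Fin r × Fin r, ∑ M : PMatch n, Y M ab.2 ab.1 * ∑ U ∈ univ.powersetCard (2 * c' + 1),
        (up^[2 * c' + 1 - 2 * κ] (p ab (2 * κ))) U * (if (U.filter fun x => M.2.partner x ∉ U).card = 1 then (1 : ℝ) else 0) = 0 := by
  classical
  -- per layer `j`, the weighted tight correlation
  set T : ℕ → ℝ := fun j => ∑ ab : Fin r × Fin r, ∑ M : PMatch n, Y M ab.2 ab.1 * ∑ U ∈ univ.powersetCard (2 * c' + 1),
    (up^[2 * c' + 1 - j] (p ab j)) U * (if (U.filter fun x => M.2.partner x ∉ U).card = 1 then (1 : ℝ) else 0) with hT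
  -- the full layer sum vanishes by tightness
  have hfull : ∑ j ∈ range (2 * c' + 1 + 1), T j = 0 := by
    have hM : ∀ M : PMatch n, ∑ ab : Fin r × Fin r, Y M ab.2 ab.1 * ∑ U ∈ univ.powersetCard (2 * c' + 1),
        (∑ j ∈ range (2 * c' + 1 + 1), up^[2 * c' + 1 - j] (p ab j)) U *
          (if (U.filter fun x => M.2.partner x ∉ U).card = 1 then (1 : ℝ) else 0) = 0 := by
      intro M
      -- `Σ_{U tight, |U| = t} tr(X_U Y_M) = 0`, expanded entrywise
      have h0 : ∑ U ∈ univ.filter (fun U : OddSet n => U.1.card = 2 * c' + 1 ∧ cc U M = 1), (X U * Y M).trace = 0 :=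
        sum_eq_zero fun U hU => by
          obtain ⟨h1, h2⟩ := (mem_filter.1 hU).2
          exact htight U M h1 h2
      refine Eq.trans ?_ h0
      simp_rw [trace_mul_eq_sum_pairs]
      rw [sum_comm]
      refine sum_congr rfl fun ab _ => ?_
      symm
      calc ∑ U ∈ univ.filter (fun U : OddSet n => U.1.card = 2 * c' + 1 ∧ cc U M = 1), X U ab.1 ab.2 * Y M ab.2 ab.1
          = ∑ U ∈ univ.filter (fun U : OddSet n => U.1.card = 2 * c' + 1 ∧ cc U M = 1),
              (fun V : Finset (Fin n) => Y M ab.2 ab.1 *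
                (∑ j ∈ range (2 * c' + 1 + 1), up^[2 * c' + 1 - j] (p ab j)) V) U.1 :=
            sum_congr rfl fun U hU => by rw [hpdec ab U (mem_filter.1 hU).2.1, mul_comm]
        _ = ∑ U ∈ (univ.powersetCard (2 * c' + 1)).filter (fun U => (U.filter fun x => M.2.partner x ∉ U).card = 1),
              Y M ab.2 ab.1 * (∑ j ∈ range (2 * c' + 1 + 1), up^[2 * c' + 1 - j] (p ab j)) U :=
            sum_tight_oddSet_eq M ⟨c', rfl⟩ (fun V : Finset (Fin n) => Y M ab.2 ab.1 *
                (∑ j ∈ range (2 * c' + 1 + 1), up^[2 * c' + 1 - j] (p ab j)) V)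
        _ = _ := by
            rw [sum_filter, mul_sum]
            refine sum_congr rfl fun U _ => ?_
            split_ifs <;> simp
    have hswap : ∑ j ∈ range (2 * c' + 1 + 1), T j = ∑ M : PMatch n, ∑ ab : Fin r × Fin r, Y M ab.2 ab.1 *
        ∑ U ∈ univ.powersetCard (2 * c' + 1), (∑ j ∈ range (2 * c' + 1 + 1), up^[2 * c' + 1 - j] (p ab j)) U *
          (if (U.filter fun x => M.2.partner x ∉ U).card = 1 then (1 : ℝ) else 0) := by
      calc ∑ j ∈ range (2 * c' + 1 + 1), T j
          = ∑ j ∈ range (2 * c' + 1 + 1), ∑ M : PMatch n, ∑ ab : Fin r × Fin r, Y M ab.2 ab.1 *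
              ∑ U ∈ univ.powersetCard (2 * c' + 1), (up^[2 * c' + 1 - j] (p ab j)) U *
                (if (U.filter fun x => M.2.partner x ∉ U).card = 1 then (1 : ℝ) else 0) := by
            simp only [hT]; exact sum_congr rfl fun j _ => sum_comm
        _ = ∑ M : PMatch n, ∑ j ∈ range (2 * c' + 1 + 1), ∑ ab : Fin r × Fin r, Y M ab.2 ab.1 *
              ∑ U ∈ univ.powersetCard (2 * c' + 1), (up^[2 * c' + 1 - j] (p ab j)) U *
                (if (U.filter fun x => M.2.partner x ∉ U).card = 1 then (1 : ℝ) else 0) := sum_comm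
        _ = ∑ M : PMatch n, ∑ ab : Fin r × Fin r, ∑ j ∈ range (2 * c' + 1 + 1), Y M ab.2 ab.1 *
              ∑ U ∈ univ.powersetCard (2 * c' + 1), (up^[2 * c' + 1 - j] (p ab j)) U *
                (if (U.filter fun x => M.2.partner x ∉ U).card = 1 then (1 : ℝ) else 0) :=
            sum_congr rfl fun M _ => sum_comm
        _ = _ := by
            refine sum_congr rfl fun M _ => sum_congr rfl fun ab _ => ?_
            rw [← mul_sum]
            congr 1
            rw [sum_comm]
            refine sum_congr rfl fun U _ => ?_
            rw [Finset.sum_apply, sum_mul]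
    rw [hswap]
    exact sum_eq_zero fun M _ => hM M
  -- odd layers vanish
  have hodd : ∀ j ∈ range (2 * c' + 1 + 1), Odd j → T j = 0 := by
    intro j hj hjo
    have hjt : j ≤ 2 * c' + 1 := by have := mem_range.1 hj; omega
    simp only [hT]
    refine sum_eq_zero fun ab _ => sum_eq_zero fun M _ => ?_
    rw [col_ladder_eq_factorial_mul_tightSum ⟨c', rfl⟩ hjt M (hp ab j), tight_column_sum_eq_zero_of_odd M ⟨c', rfl⟩ hjo (hp ab j)]
    ring
  -- keep the even layers `j = 2κ`, `κ ≤ c'`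
  rw [← sum_filter_add_sum_filter_not (range (2 * c' + 1 + 1)) (fun j => Even j)] at hfull
  have hodd0 : ∑ j ∈ (range (2 * c' + 1 + 1)).filter (fun j => ¬Even j), T j = 0 :=
    sum_eq_zero fun j hj => hodd j (mem_filter.1 hj).1 (Nat.not_even_iff_odd.1 (mem_filter.1 hj).2)
  rw [hodd0, add_zero] at hfull
  have hre : ∑ j ∈ (range (2 * c' + 1 + 1)).filter (fun j => Even j), T j = ∑ κ ∈ range (c' + 1), T (2 * κ) := by
    rw [sum_filter]
    symm
    refine sum_of_injOn (fun κ => 2 * κ) (fun a _ b _ h => by simpa using h) ?_ ?_ ?_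
    · intro κ hκ; simp only [coe_range, Set.mem_Iio] at hκ ⊢; omega
    · intro j hj hnot
      simp only [Set.mem_image, coe_range, Set.mem_Iio, not_exists, not_and] at hnot
      rw [if_neg]
      rintro ⟨κ, hκ⟩
      exact hnot κ (by have := mem_range.1 hj; omega) (by omega)
    · intro κ _
      rw [if_pos ⟨κ, by ring⟩]
  rw [hre] at hfull
  simpa only [hT] using hfull

/-! ### §3 The exact mode budget of a tight strategy -/

/-- **THE MODE BUDGET.** For `n` even, `t = 2c'+1`, `2t ≤ n`, `D ≤ 2c'`, matrix-valued `X, Y` with `tr(X_U Y_M) = 0` on the tight `t`-cut pairs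
and entrywise harmonic layers `p^{ab}`:
`(Σ_M Σ_{|A|≤D} tr(Q_A Y_M)·knapsackMoment(|M|, t/2, x_M(A)))·N₁ = Σ_{κ=1}^{D/2} (R_κ − 1)·C_κ − Σ_{κ=D/2+1}^{c'} C_κ`.
[cite: Grigoriev2001, Lemma 1.4 (PDF p. 8)] [cite: Rothvoss2017, §2 (PDF p. 6)] [cite: GriblingDelaatLaurent2019, §5] -/
theorem tight_virtual_modeBudget {c' D r : ℕ} (hn : Even n) (ht : 2 * (2 * c' + 1) ≤ n) (hD : D ≤ 2 * c')
    (X : OddSet n → Matrix (Fin r) (Fin r) ℝ) (Y : PMatch n → Matrix (Fin r) (Fin r) ℝ)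
    (htight : ∀ (U : OddSet n) (M : PMatch n), U.1.card = 2 * c' + 1 → cc U M = 1 → (X U * Y M).trace = 0)
    (p : Fin r × Fin r → ℕ → Finset (Fin n) → ℝ) (hp : ∀ ab j, IsHarmonic j (p ab j))
    (hpdec : ∀ ab (U : OddSet n), U.1.card = 2 * c' + 1 →
      X U ab.1 ab.2 = (∑ j ∈ range (2 * c' + 1 + 1), up^[2 * c' + 1 - j] (p ab j)) U.1) :
    (∑ M : PMatch n, ∑ A : {A : Finset (Fin n) // A.card ≤ D},
        (Matrix.of (fun a b : Fin r =>
          (∑ j ∈ range (2 * c' + 1 + 1), ((2 * c' + 1 - j).factorial : ℝ) • (if D < j then 0 else p (a, b) j)) A.1) * Y M).trace *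
          knapsackMoment M.1.card (((2 * c' + 1 : ℕ) : ℝ) / 2) (M.1.filter fun e => ∃ a ∈ A.1, a ∈ e).card) *
        ((((n / 2).choose (1 + c') * (1 + c').choose c' * 2 ^ 1 : ℕ) : ℝ)) =
      ∑ κ ∈ Icc 1 (D / 2),
        ((∏ i ∈ range κ, (((2 * c' + 1 : ℝ) - 2 * i) * ((n : ℝ) - 2 * c' - 1 - 2 * i) /
            (((2 * c' : ℝ) - 2 * i) * ((n : ℝ) - 2 * c' - 2 - 2 * i)))) - 1) *
          ∑ ab : Fin r × Fin r, ∑ M : PMatch n, Y M ab.2 ab.1 * ∑ U ∈ univ.powersetCard (2 * c' + 1),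
            (up^[2 * c' + 1 - 2 * κ] (p ab (2 * κ))) U * (if (U.filter fun x => M.2.partner x ∉ U).card = 1 then (1 : ℝ) else 0) -
      ∑ κ ∈ Icc (D / 2 + 1) c', ∑ ab : Fin r × Fin r, ∑ M : PMatch n, Y M ab.2 ab.1 * ∑ U ∈ univ.powersetCard (2 * c' + 1),
            (up^[2 * c' + 1 - 2 * κ] (p ab (2 * κ))) U * (if (U.filter fun x => M.2.partner x ∉ U).card = 1 then (1 : ℝ) else 0) := by
  classical
  set C : ℕ → ℝ := fun κ => ∑ ab : Fin r × Fin r, ∑ M : PMatch n, Y M ab.2 ab.1 * ∑ U ∈ univ.powersetCard (2 * c' + 1),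
    (up^[2 * c' + 1 - 2 * κ] (p ab (2 * κ))) U * (if (U.filter fun x => M.2.partner x ∉ U).card = 1 then (1 : ℝ) else 0) with hC
  set R : ℕ → ℝ := fun κ => ∏ i ∈ range κ, (((2 * c' + 1 : ℝ) - 2 * i) * ((n : ℝ) - 2 * c' - 1 - 2 * i) /
    (((2 * c' : ℝ) - 2 * i) * ((n : ℝ) - 2 * c' - 2 - 2 * i))) with hR
  rw [virtual_psd_mul_eq hn ht hD p hp Y]
  have hzero := tight_modes_sum_eq_zero X Y htight p hp hpdec
  change ∑ κ ∈ range (D / 2 + 1), R κ * C κ = ∑ κ ∈ Icc 1 (D / 2), (R κ - 1) * C κ - ∑ κ ∈ Icc (D / 2 + 1) c', C κ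
  change ∑ κ ∈ range (c' + 1), C κ = 0 at hzero
  -- split `range (D/2+1) = {0} ∪ Icc 1 (D/2)` and `range (c'+1) = {0} ∪ Icc 1 (D/2) ∪ Icc (D/2+1) c'`
  have hs1 : range (D / 2 + 1) = insert 0 (Icc 1 (D / 2)) := by ext κ; simp only [mem_range, mem_insert, mem_Icc]; omega
  have hs2 : range (c' + 1) = insert 0 (Icc 1 (D / 2) ∪ Icc (D / 2 + 1) c') := by
    ext κ; simp only [mem_range, mem_insert, mem_union, mem_Icc]; omega
  have hdisj : Disjoint (Icc 1 (D / 2)) (Icc (D / 2 + 1) c') := by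
    rw [disjoint_left]; intro κ h1 h2; rw [mem_Icc] at h1 h2; omega
  rw [hs2, sum_insert (by simp), sum_union hdisj] at hzero
  rw [hs1, sum_insert (by simp)]
  have hR0 : R 0 = 1 := by simp [hR]
  rw [hR0, one_mul]
  have hsub : ∑ κ ∈ Icc 1 (D / 2), (R κ - 1) * C κ = ∑ κ ∈ Icc 1 (D / 2), R κ * C κ - ∑ κ ∈ Icc 1 (D / 2), C κ := by
    rw [← sum_sub_distrib]; exact sum_congr rfl fun κ _ => by ring
  rw [hsub]
  linarith

end Summit.PneNP.PneNP.Theorems.ChebyshevTracialDesignTightModeBudget
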